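import Mathlib.Analysis.SpecialFunctions.Integrals.Basic
import Mathlib.Analysis.SpecialFunctions.Integrability.Basic
import Mathlib.MeasureTheory.Integral.Prod
import Mathlib.MeasureTheory.Measure.Lebesgue.Basic
import Mathlib.MeasureTheory.Constructions.BorelSpace.Basic
import HarnessLib

/-!
# Logarithmic energy vs. the diagonal `H^{1/2}` energy, I: kernels and the four-variable region

Topic `Analysis/Potential`, namespace `Literature.Analysis.Potential` (technical objects in the
sub-namespace `LogEnergy`). First of three files (`LogEnergyKernels`, `LogEnergyFubini`,
`LogEnergyDiagonalBound`) proving the inequality behind Vershik–Kerov's identity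
`-∬ log |2(s-t)| f'(s) f'(t) ds dt = ½ ‖f‖²_{1/2}`, `‖f‖²_{1/2} = ∬ ((f(s)-f(t))/(s-t))² ds dt`
(Vershik–Kerov 1985, Lemmas 2–3; quoted in S. Mkrtchyan, Europ. J. Combin. 33 (2012),
arXiv:1008.3854, proof of Prop. 4.1: "Vershik and Kerov [VK85] have shown that …"), in the form
consumed by the Vershik–Kerov upper bound for the dimensions of the irreducible representations of
`𝔖ₙ` (`Literature/RepresentationTheory/FiniteGroups/VershikKerov*`): for a bounded measurable
`ψ = f'` with compact support and `∫ ψ = 0`,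
`∑_k ∬_{[k,k+1)²} (∫_x^y ψ)²/(y-x)² ≤ -2 ∬ ψ(s)ψ(t) log|s-t|` (`LogEnergyDiagonalBound.lean`).

The proof is the regularised identity on the box `(-R, R)²`:
`∬_{(-R,R)²} (∫_x^y ψ)²/(y-x)² dx dy = ∫∫ ψ(s)ψ(t) w_R(s,t) ds dt`, obtained by writing
`(∫_x^y ψ)² = ∫∫_{[x,y]²} ψ(s)ψ(t)` and exchanging the order of integration in FOUR variables
(Fubini for the integrand `F((x,y),(s,t)) = 1/(y-x)² · 1_{s,t between x and y} ψ(s)ψ(t)`), with the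
weight in closed form `w_R(s,t) = 2(log(M+R) + log(R-m) - log 2R - log(M-m))`, `m = min`, `M = max`,
`= 2(log R - log 2 + O(A/R) - log|s-t|)` on the support; the constant integrates to `0` against
`ψ ⊗ ψ` and `R → ∞`. This file: the one-dimensional kernels
(`∫ dy/(y-x)²`, `∫ (dx/(M-x) - dx/(R-x))`) and the region/integrand with their measurability and the
two slice formulas.

## References

* A. M. Vershik, S. V. Kerov, Funct. Anal. Appl. 19 (1985) 21–31, Lemmas 2–3. [VershikKerov1985]
* S. Mkrtchyan, Europ. J. Combin. 33 (2012), arXiv:1008.3854, Prop. 4.1. [Mkrtchyan2012]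

## Mathlib

`intervalIntegral.integral_eq_sub_of_hasDerivAt_of_le`, `integral_inv_of_pos`,
`intervalIntegral.integral_comp_sub_left/right`, `measurableSet_lt`, `Set.indicator`. No
logarithmic/`H^{1/2}` energy identities exist in Mathlib (searched `Gagliardo`, `logEnergy`).
-/

noncomputable section

open MeasureTheory Set Filter intervalIntegral
open scoped Real Interval ENNReal

namespace Literature.Analysis.Potential

/-! ### 1D kernels -/

/-- `∫_M^R dy/(y-x)² = 1/(M-x) - 1/(R-x)` for `x < M ≤ R`. [folklore] -/
theorem integral_inv_sq_sub {x M R : ℝ} (hxM : x < M) (hMR : M ≤ R) :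
    ∫ y in M..R, ((y - x) ^ 2)⁻¹ = (M - x)⁻¹ - (R - x)⁻¹ := by
  have hderiv : ∀ y ∈ Ioo M R, HasDerivAt (fun y : ℝ => -(y - x)⁻¹) (((y - x) ^ 2)⁻¹) y := by
    intro y hy
    have hne : y - x ≠ 0 := by linarith [hy.1]
    have h := ((hasDerivAt_id y).sub_const x).inv hne
    simp only [id_eq] at h
    exact h.neg.congr_deriv (by field_simp)
  have hcont : ContinuousOn (fun y : ℝ => -(y - x)⁻¹) (Icc M R) := by
    refine ContinuousOn.neg (ContinuousOn.inv₀ (by fun_prop) fun y hy => ?_)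
    linarith [hy.1]
  have hint : IntervalIntegrable (fun y : ℝ => ((y - x) ^ 2)⁻¹) volume M R := by
    refine (ContinuousOn.inv₀ (by fun_prop) fun y hy => ?_).intervalIntegrable
    rw [uIcc_of_le hMR] at hy
    have : 0 < y - x := by linarith [hy.1]
    positivity
  rw [intervalIntegral.integral_eq_sub_of_hasDerivAt_of_le hMR hcont hderiv hint]
  ring

/-- `∫_{-R}^{m} (dx/(M-x) - dx/(R-x)) = log((M+R)/(M-m)) - log(2R/(R-m))` for `-R < m ≤ M < R`
(so `-R ≤ m`). [folklore] -/
theorem integral_inv_sub_inv {m M R : ℝ} (hRm : -R ≤ m) (hmM : m < M) (hMR : M < R) :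
    ∫ x in (-R)..m, ((M - x)⁻¹ - (R - x)⁻¹) =
      Real.log ((M + R) / (M - m)) - Real.log ((R + R) / (R - m)) := by
  have h1 : ∫ x in (-R)..m, (M - x)⁻¹ = Real.log ((M + R) / (M - m)) := by
    rw [intervalIntegral.integral_comp_sub_left (fun u => u⁻¹) M, integral_inv_of_pos (by linarith)
      (by linarith), sub_neg_eq_add]
  have h2 : ∫ x in (-R)..m, (R - x)⁻¹ = Real.log ((R + R) / (R - m)) := by
    rw [intervalIntegral.integral_comp_sub_left (fun u => u⁻¹) R, integral_inv_of_pos (by linarith)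
      (by linarith), sub_neg_eq_add]
  have hi1 : IntervalIntegrable (fun x : ℝ => (M - x)⁻¹) volume (-R) m := by
    refine (ContinuousOn.inv₀ (by fun_prop) fun x hx => ?_).intervalIntegrable
    rw [uIcc_of_le hRm] at hx
    linarith [hx.2]
  have hi2 : IntervalIntegrable (fun x : ℝ => (R - x)⁻¹) volume (-R) m := by
    refine (ContinuousOn.inv₀ (by fun_prop) fun x hx => ?_).intervalIntegrable
    rw [uIcc_of_le hRm] at hx
    linarith [hx.2]
  rw [intervalIntegral.integral_sub hi1 hi2, h1, h2]

/-- Mirror of `integral_inv_sq_sub`: `∫_{-R}^{m} dy/(y-x)² = 1/(x-m) - 1/(x+R)` for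
`-R ≤ m < x`. [folklore] -/
theorem integral_inv_sq_sub' {x m R : ℝ} (hRm : -R ≤ m) (hmx : m < x) :
    ∫ y in (-R)..m, ((y - x) ^ 2)⁻¹ = (x - m)⁻¹ - (x + R)⁻¹ := by
  have hderiv : ∀ y ∈ Ioo (-R) m, HasDerivAt (fun y : ℝ => -(y - x)⁻¹) (((y - x) ^ 2)⁻¹) y := by
    intro y hy
    have hne : y - x ≠ 0 := by linarith [hy.2]
    have h := ((hasDerivAt_id y).sub_const x).inv hne
    simp only [id_eq] at h
    exact h.neg.congr_deriv (by field_simp)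
  have hcont : ContinuousOn (fun y : ℝ => -(y - x)⁻¹) (Icc (-R) m) := by
    refine ContinuousOn.neg (ContinuousOn.inv₀ (by fun_prop) fun y hy => ?_)
    linarith [hy.2]
  have hint : IntervalIntegrable (fun y : ℝ => ((y - x) ^ 2)⁻¹) volume (-R) m := by
    refine (ContinuousOn.inv₀ (by fun_prop) fun y hy => ?_).intervalIntegrable
    rw [uIcc_of_le hRm] at hy
    have : y - x ≠ 0 := by linarith [hy.2]
    positivity
  rw [intervalIntegral.integral_eq_sub_of_hasDerivAt_of_le hRm hcont hderiv hint]
  have h1 : m - x ≠ 0 := by linarith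
  have h2 : -R - x ≠ 0 := by linarith
  have h3 : x - m ≠ 0 := by linarith
  have h4 : x + R ≠ 0 := by linarith
  field_simp
  ring

/-- `∫_{M'}^{R} (dx/(x-m) - dx/(x+R)) = log((R-m)/(M'-m)) - log(2R/(M'+R))` for `m < M' ≤ R`,
`-R < M'`. [folklore] -/
theorem integral_inv_sub_inv' {m M R : ℝ} (hRM : -R < M) (hmM : m < M) (hMR : M ≤ R) :
    ∫ x in M..R, ((x - m)⁻¹ - (x + R)⁻¹) =
      Real.log ((R - m) / (M - m)) - Real.log ((R + R) / (M + R)) := by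
  have h1 : ∫ x in M..R, (x - m)⁻¹ = Real.log ((R - m) / (M - m)) := by
    rw [intervalIntegral.integral_comp_sub_right (fun u => u⁻¹) m,
      integral_inv_of_pos (by linarith) (by linarith)]
  have h2 : ∫ x in M..R, (x + R)⁻¹ = Real.log ((R + R) / (M + R)) := by
    rw [intervalIntegral.integral_comp_add_right (fun u => u⁻¹) R,
      integral_inv_of_pos (by linarith) (by linarith)]
  have hi1 : IntervalIntegrable (fun x : ℝ => (x - m)⁻¹) volume M R := by
    refine (ContinuousOn.inv₀ (by fun_prop) fun x hx => ?_).intervalIntegrable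
    rw [uIcc_of_le hMR] at hx
    linarith [hx.1]
  have hi2 : IntervalIntegrable (fun x : ℝ => (x + R)⁻¹) volume M R := by
    refine (ContinuousOn.inv₀ (by fun_prop) fun x hx => ?_).intervalIntegrable
    rw [uIcc_of_le hMR] at hx
    linarith [hx.1]
  rw [intervalIntegral.integral_sub hi1 hi2, h1, h2]

/-! ### `log |·|` has uniformly bounded integrals over bounded windows -/

/-- `∫_a^b |log |x - c|| dx ≤ ∫_{-D}^{D} |log u| du` whenever `[a - c, b - c] ⊆ [-D, D]`. [folklore] -/
theorem integral_abs_log_abs_sub_le {a b c D : ℝ} (hab : a ≤ b) (h1 : -D ≤ a - c) (h2 : b - c ≤ D) :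
    ∫ x in a..b, |Real.log (|x - c|)| ≤ ∫ u in (-D)..D, |Real.log u| := by
  have hsub : (∫ x in a..b, |Real.log (|x - c|)|) = ∫ u in (a - c)..(b - c), |Real.log u| := by
    rw [← intervalIntegral.integral_comp_sub_right (fun u => |Real.log u|) c]
    refine intervalIntegral.integral_congr fun x _ => ?_
    simp only [Real.log_abs]
  rw [hsub]
  exact intervalIntegral.integral_mono_interval h1 (by linarith) h2
    (Eventually.of_forall fun u => abs_nonneg _) intervalIntegrable_log'.norm



/-! ## The four-variable region and integrand -/

namespace LogEnergy

open Function

variable {ψ : ℝ → ℝ} {C R : ℝ}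

/-- The open box `(-R, R)²`. [folklore] -/
def sqBox (R : ℝ) : Set (ℝ × ℝ) := Ioo (-R) R ×ˢ Ioo (-R) R

/-- `(-R, R)²` is measurable. [folklore] -/
theorem measurableSet_sqBox (R : ℝ) : MeasurableSet (sqBox R) :=
  measurableSet_Ioo.prod measurableSet_Ioo

/-- `r` lies strictly between the two coordinates of `p`. [folklore] -/
def Sbtw (p : ℝ × ℝ) (r : ℝ) : Prop := min p.1 p.2 < r ∧ r < max p.1 p.2

/-- The region of integration in `(ℝ × ℝ) × (ℝ × ℝ)`: `p ∈ (-R,R)²` and both coordinates of `q`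
strictly between the coordinates of `p`. [folklore] -/
def quadRegion (R : ℝ) : Set ((ℝ × ℝ) × (ℝ × ℝ)) :=
  {z | z.1 ∈ sqBox R ∧ Sbtw z.1 z.2.1 ∧ Sbtw z.1 z.2.2}

/-- `p ↦ min p.1 p.2` is measurable. [folklore] -/
theorem measurable_min_fst_snd : Measurable fun p : ℝ × ℝ => min p.1 p.2 :=
  measurable_fst.min measurable_snd

/-- `p ↦ max p.1 p.2` is measurable. [folklore] -/
theorem measurable_max_fst_snd : Measurable fun p : ℝ × ℝ => max p.1 p.2 :=
  measurable_fst.max measurable_snd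

/-- The four-variable region is measurable. [folklore] -/
theorem measurableSet_quadRegion (R : ℝ) : MeasurableSet (quadRegion R) := by
  have h1 : MeasurableSet {z : (ℝ × ℝ) × (ℝ × ℝ) | z.1 ∈ sqBox R} :=
    measurable_fst (measurableSet_sqBox R)
  have hmin : Measurable fun z : (ℝ × ℝ) × (ℝ × ℝ) => min z.1.1 z.1.2 :=
    measurable_min_fst_snd.comp measurable_fst
  have hmax : Measurable fun z : (ℝ × ℝ) × (ℝ × ℝ) => max z.1.1 z.1.2 :=
    measurable_max_fst_snd.comp measurable_fst
  have h2 : MeasurableSet {z : (ℝ × ℝ) × (ℝ × ℝ) | min z.1.1 z.1.2 < z.2.1} :=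
    measurableSet_lt hmin (measurable_fst.comp measurable_snd)
  have h3 : MeasurableSet {z : (ℝ × ℝ) × (ℝ × ℝ) | z.2.1 < max z.1.1 z.1.2} :=
    measurableSet_lt (measurable_fst.comp measurable_snd) hmax
  have h4 : MeasurableSet {z : (ℝ × ℝ) × (ℝ × ℝ) | min z.1.1 z.1.2 < z.2.2} :=
    measurableSet_lt hmin (measurable_snd.comp measurable_snd)
  have h5 : MeasurableSet {z : (ℝ × ℝ) × (ℝ × ℝ) | z.2.2 < max z.1.1 z.1.2} :=
    measurableSet_lt (measurable_snd.comp measurable_snd) hmax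
  have : quadRegion R = {z | z.1 ∈ sqBox R} ∩ (({z | min z.1.1 z.1.2 < z.2.1} ∩
      {z | z.2.1 < max z.1.1 z.1.2}) ∩ ({z | min z.1.1 z.1.2 < z.2.2} ∩
        {z : (ℝ × ℝ) × (ℝ × ℝ) | z.2.2 < max z.1.1 z.1.2})) := by
    ext z; simp only [quadRegion, Sbtw, mem_setOf_eq, mem_inter_iff]
  rw [this]
  exact h1.inter ((h2.inter h3).inter (h4.inter h5))

/-- The kernel `ψ(s) ψ(t) / (y - x)²`. [folklore] -/
def quadKernel (ψ : ℝ → ℝ) (z : (ℝ × ℝ) × (ℝ × ℝ)) : ℝ :=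
  ((z.1.2 - z.1.1) ^ 2)⁻¹ * (ψ z.2.1 * ψ z.2.2)

/-- The four-variable integrand. [folklore] -/
def quadF (ψ : ℝ → ℝ) (R : ℝ) : (ℝ × ℝ) × (ℝ × ℝ) → ℝ :=
  (quadRegion R).indicator (quadKernel ψ)

/-- The kernel is measurable. [folklore] -/
theorem measurable_quadKernel (hψ : Measurable ψ) : Measurable (quadKernel ψ) := by
  unfold quadKernel
  refine Measurable.mul ?_ ?_
  · exact ((measurable_snd.comp measurable_fst).sub (measurable_fst.comp measurable_fst)).pow_const 2
      |>.inv
  · exact (hψ.comp (measurable_fst.comp measurable_snd)).mul (hψ.comp (measurable_snd.comp measurable_snd))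

/-- The four-variable integrand is measurable. [folklore] -/
theorem measurable_quadF (hψ : Measurable ψ) (R : ℝ) : Measurable (quadF ψ R) :=
  (measurable_quadKernel hψ).indicator (measurableSet_quadRegion R)

/-- The `p`-section of the region: the interval strictly between the coordinates. [folklore] -/
def btwI (p : ℝ × ℝ) : Set ℝ := Ioo (min p.1 p.2) (max p.1 p.2)

/-- Slice in `q` for fixed `p`. [folklore] -/
theorem quadF_apply_left (ψ : ℝ → ℝ) (R : ℝ) (p q : ℝ × ℝ) :
    quadF ψ R (p, q) = (sqBox R).indicator (fun p => ((p.2 - p.1) ^ 2)⁻¹) p *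
      ((btwI p).indicator ψ q.1 * (btwI p).indicator ψ q.2) := by
  unfold quadF
  by_cases hp : p ∈ sqBox R
  · by_cases h1 : q.1 ∈ btwI p
    · by_cases h2 : q.2 ∈ btwI p
      · have hz : (p, q) ∈ quadRegion R := ⟨hp, h1, h2⟩
        rw [Set.indicator_of_mem hz, Set.indicator_of_mem hp, Set.indicator_of_mem h1,
          Set.indicator_of_mem h2]
        rfl
      · have hz : (p, q) ∉ quadRegion R := fun h => h2 h.2.2
        rw [Set.indicator_of_notMem hz, Set.indicator_of_notMem h2, mul_zero, mul_zero]
    · have hz : (p, q) ∉ quadRegion R := fun h => h1 h.2.1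
      rw [Set.indicator_of_notMem hz, Set.indicator_of_notMem h1, zero_mul, mul_zero]
  · have hz : (p, q) ∉ quadRegion R := fun h => hp h.1
    rw [Set.indicator_of_notMem hz, Set.indicator_of_notMem hp, zero_mul]

/-- The `q`-section weight. [folklore] -/
def quadV (R : ℝ) (q : ℝ × ℝ) : Set (ℝ × ℝ) := {p | p ∈ sqBox R ∧ Sbtw p q.1 ∧ Sbtw p q.2}

/-- The `q`-section is measurable. [folklore] -/
theorem measurableSet_quadV (R : ℝ) (q : ℝ × ℝ) : MeasurableSet (quadV R q) := by
  have : quadV R q = (fun p : ℝ × ℝ => (p, q)) ⁻¹' quadRegion R := by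
    ext p; simp [quadV, quadRegion]
  rw [this]
  exact measurable_prodMk_right (measurableSet_quadRegion R)

/-- Slice in `p` for fixed `q`. [folklore] -/
theorem quadF_apply_right (ψ : ℝ → ℝ) (R : ℝ) (p q : ℝ × ℝ) :
    quadF ψ R (p, q) = ψ q.1 * ψ q.2 * (quadV R q).indicator (fun p => ((p.2 - p.1) ^ 2)⁻¹) p := by
  unfold quadF quadKernel
  by_cases h : (p, q) ∈ quadRegion R
  · rw [indicator_of_mem h, indicator_of_mem (show p ∈ quadV R q from h)]
    ring
  · rw [indicator_of_notMem h, indicator_of_notMem (show p ∉ quadV R q from h), mul_zero]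



end LogEnergy

end Literature.Analysis.Potential

end
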